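import Summits.ResolutionOfSingularities.ResolutionOfSingularities.Theorems.WildQuotientsSummitReductionStubPairOrbitBlowupCentreLocalLemmas4
import HarnessLib

/-!
# `WildQuotients.SummitReduction` (stmt-ResolutionOfSingularities-16324), line `FramePerfect`:
# the special fibre of a chart at an arbitrary prime over the base, as a local ring of the model
# `l[x, y]/(xy - ā)` over the residue field (algebra of stub `stub_pair_orbitBlowupCentreLocal`, file 11)

Route `ResolutionOfSingularities/WildQuotients`, crux `SummitReduction`; helper file of stub
`stub_pair_orbitBlowupCentreLocal` (C2: de Jong 1996, 3.4 Claim (ii) over the orbit centre). File 6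
puts the completed local ring of the blown-up curve at a point `x'` over the centre in the form
`(R_𝔔)^` for a chart ring `R = Λ[x, y]/(xy - a₀)` over the Cohen coordinates `Λ` of the base and a
prime `𝔔 ⊇ 𝔪_Λ R`; file 4 treated the ORIGIN `𝔔 ∋ x̄, ȳ`. For clause (H4) off the origins and for
clause (H2) one needs every prime `𝔔 ⊇ 𝔪_Λ R`: this file PROVES that **the special fibre
`R_𝔔/𝔪_Λ R_𝔔` of the chart is the local ring of the model `l[x, y]/(xy - ā)` over ANY copy `l` of
the residue field `Λ/𝔪_Λ` at a prime `𝔔_l`, containing `x̄` (resp. `ȳ`) iff `𝔔` does, compatibly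
with the scalars** (`exists_chartFibre_equiv_localization_model`): `R/𝔪_Λ R ≅ (Λ/𝔪_Λ)[x, y]/(xy - ā)`
(`AlgebraicNodeRing.quotientEquiv`), coefficients are changed along `l ≅ Λ/𝔪_Λ`
(`AlgebraicNodeRing.exists_ringEquiv_of_ringEquiv`), and quotients commute with localization. The
copy `l` is the residue field of the base local ring `A` (`exists_ringEquiv_residueField_of_cohen`:
`A → Λ` residually bijective), so that the comparison is over `κ(y)` as clause (H2) requires.
("For the convenience of the reader we give the special fibre intersected with this chart; it is
the spectrum of the ring `k[u, t₁']/(ut₁')`", de Jong 1996, p. 64.)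
-/

set_option linter.dupNamespace false

noncomputable section

open IsLocalRing
open Literature.AlgebraicGeometry.Resolution
open Literature.AlgebraicGeometry.Resolution.DeJong1996

namespace Summit.ResolutionOfSingularities.ResolutionOfSingularities.Theorems

universe u

/-! ## Change of coefficients in `R[x, y]/(xy - a)` -/

section Coefficients

/-- **`R[x, y]/(xy - a) ≅ S[x, y]/(xy - e a)` along a ring isomorphism `e : R ≅ S`**, reducing the
coefficients of representatives. [folklore] -/
theorem AlgebraicNodeRing.exists_ringEquiv_of_ringEquiv {R S : Type u} [CommRing R] [CommRing S]
    (e : R ≃+* S) (a : R) :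
    ∃ τ : AlgebraicNodeRing R a ≃+* AlgebraicNodeRing S (e a),
      ∀ p : MvPolynomial (Fin 2) R, τ (AlgebraicNodeRing.mk R a p) =
        AlgebraicNodeRing.mk S (e a) (MvPolynomial.map (e : R →+* S) p) := by
  have hJ : Ideal.span {algNodeRelation S (e a)} =
      (Ideal.span {algNodeRelation R a}).map
        ((MvPolynomial.mapEquiv (Fin 2) e : MvPolynomial (Fin 2) R ≃+* MvPolynomial (Fin 2) S) :
          MvPolynomial (Fin 2) R →+* MvPolynomial (Fin 2) S) := by
    rw [Ideal.map_span, Set.image_singleton]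
    congr 2
    change _ = MvPolynomial.map (e : R →+* S) (algNodeRelation R a)
    rw [AlgebraicNodeRing.map_algNodeRelation]
    rfl
  refine ⟨Ideal.quotientEquiv _ _ (MvPolynomial.mapEquiv (Fin 2) e) hJ, fun p => ?_⟩
  rw [AlgebraicNodeRing.mk_apply, AlgebraicNodeRing.mk_apply, Ideal.quotientEquiv_mk]
  rfl

end Coefficients

/-! ## The residue field of the base in Cohen coordinates -/

section Residue

/-- **A copy `l` of the residue field of `A` is identified with the residue field of `Λ`** along a
ring map `β : A → Λ` with `𝔪_A Λ = 𝔪_Λ` which is residually onto (e.g. Cohen coordinates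
`A → Â ≅ Λ`): the isomorphism sends the class of `a` to the residue of `β a`. [folklore] -/
theorem exists_ringEquiv_residueField_of_cohen {A Λ : Type u} [CommRing A] [IsLocalRing A]
    [CommRing Λ] [IsLocalRing Λ] (l : Type u) [Field l] [Algebra A l]
    (hl : Function.Surjective (algebraMap A l)) (hlk : ∀ a, algebraMap A l a = 0 ↔ a ∈ maximalIdeal A)
    (β : A →+* Λ) (hβM : (maximalIdeal A).map β = maximalIdeal Λ)
    (hβR : Function.Surjective ((Ideal.Quotient.mk (maximalIdeal Λ)).comp β)) :
    ∃ eκ : l ≃+* ResidueField Λ, ∀ a, eκ (algebraMap A l a) = residue Λ (β a) := by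
  set g : A →+* ResidueField Λ := (residue Λ).comp β with hg
  have hker : RingHom.ker (algebraMap A l) ≤ RingHom.ker g := by
    intro a ha
    rw [RingHom.mem_ker] at ha ⊢
    rw [hg, RingHom.comp_apply, residue_eq_zero_iff, ← hβM]
    exact Ideal.mem_map_of_mem β ((hlk a).mp ha)
  let φ : l →+* ResidueField Λ := (algebraMap A l).liftOfSurjective hl ⟨g, hker⟩
  have hφ : ∀ a, φ (algebraMap A l a) = residue Λ (β a) := fun a =>
    (algebraMap A l).liftOfSurjective_comp_apply hl ⟨g, hker⟩ a
  have hbij : Function.Bijective φ := by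
    refine ⟨φ.injective, fun z => ?_⟩
    obtain ⟨a, ha⟩ := hβR z
    exact ⟨algebraMap A l a, by rw [hφ]; exact ha⟩
  exact ⟨RingEquiv.ofBijective φ hbij, hφ⟩

end Residue

/-! ## The special fibre of the chart at a prime over the base -/

section ChartFibre

variable {Λ : Type u} [CommRing Λ] [IsLocalRing Λ] {R : Type u} [CommRing R] [Algebra Λ R]
  (𝔔 : Ideal R) [𝔔.IsPrime]
  (h𝔔Λ : (maximalIdeal Λ).map (algebraMap Λ R) ≤ 𝔔)
  (T : Type u) [CommRing T] [Algebra R T] [IsLocalization.AtPrime T 𝔔]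
  (l : Type u) [Field l] (eκ : l ≃+* ResidueField Λ) {abar : ResidueField Λ}
  (eR : (R ⧸ (maximalIdeal Λ).map (algebraMap Λ R)) ≃+* AlgebraicNodeRing (ResidueField Λ) abar)
  (heR : ∀ lam : Λ, eR (Ideal.Quotient.mk _ (algebraMap Λ R lam)) =
    algebraMap (ResidueField Λ) _ (residue Λ lam))

include h𝔔Λ heR in
/-- **Abstract form of `exists_chartFibre_equiv_localization_model`**: the chart ring `R` enters only
through an identification `eR : R/𝔪_Λ R ≅ κ[x, y]/(xy - ā)` over `κ = Λ/𝔪_Λ`; then `T/𝔪_Λ T`, `T` a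
local ring of `R` at a prime `𝔔 ⊇ 𝔪_Λ R`, is a local ring of `l[x, y]/(xy - ā)` (coefficients moved
along `eκ : l ≅ κ`) at the prime `𝔔_l` corresponding to `𝔔̄`, compatibly with the scalars `Λ → l`.
[cite: DeJong1996, 3.4 Claim (ii), p. 64] -/
theorem exists_quotient_equiv_localization_model_of_quotient_equiv :
    ∃ (𝔔l : Ideal (AlgebraicNodeRing l (eκ.symm abar))) (_ : 𝔔l.IsPrime)
      (ι : (T ⧸ ((maximalIdeal Λ).map (algebraMap Λ R)).map (algebraMap R T)) ≃+*
        Localization.AtPrime 𝔔l),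
      (∀ (r : R) (p : MvPolynomial (Fin 2) (ResidueField Λ)),
        eR (Ideal.Quotient.mk _ r) = AlgebraicNodeRing.mk (ResidueField Λ) abar p →
          (AlgebraicNodeRing.mk l (eκ.symm abar) (MvPolynomial.map (eκ.symm : ResidueField Λ →+* l) p) ∈ 𝔔l ↔
            r ∈ 𝔔)) ∧
      (∀ lam : Λ, ι (Ideal.Quotient.mk _ (algebraMap R T (algebraMap Λ R lam))) =
        algebraMap l (Localization.AtPrime 𝔔l) (eκ.symm (residue Λ lam))) := by
  classical
  -- the quotient prime `𝔔̄` of `R/I`, `I = 𝔪_Λ R`, and the localization `T/IT`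
  haveI h𝔔b : (𝔔.map (Ideal.Quotient.mk ((maximalIdeal Λ).map (algebraMap Λ R)))).IsPrime :=
    isPrime_map_quotient_mk 𝔔 h𝔔Λ
  haveI hloc : IsLocalization.AtPrime (T ⧸ (((maximalIdeal Λ).map (algebraMap Λ R)).map (algebraMap R T)))
      (𝔔.map (Ideal.Quotient.mk ((maximalIdeal Λ).map (algebraMap Λ R)))) := by
    have inst : @IsLocalization (R ⧸ ((maximalIdeal Λ).map (algebraMap Λ R))) _
        (Algebra.algebraMapSubmonoid (R ⧸ ((maximalIdeal Λ).map (algebraMap Λ R))) 𝔔.primeCompl)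
        (T ⧸ (((maximalIdeal Λ).map (algebraMap Λ R)).map (algebraMap R T))) _ _ := inferInstance
    rwa [algebraMapSubmonoid_quotient_primeCompl 𝔔 h𝔔Λ] at inst
  -- `R/I ≅ κ[x, y]/(xy - ā) ≅ l[x, y]/(xy - ā_l)`
  obtain ⟨τ₂, hτ₂⟩ := AlgebraicNodeRing.exists_ringEquiv_of_ringEquiv eκ.symm abar
  let τ : (R ⧸ (maximalIdeal Λ).map (algebraMap Λ R)) ≃+* AlgebraicNodeRing l (eκ.symm abar) :=
    eR.trans τ₂
  have hτ : ∀ (r : R) (p : MvPolynomial (Fin 2) (ResidueField Λ)),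
      eR (Ideal.Quotient.mk _ r) = AlgebraicNodeRing.mk (ResidueField Λ) abar p →
        τ (Ideal.Quotient.mk _ r) =
          AlgebraicNodeRing.mk l (eκ.symm abar) (MvPolynomial.map (eκ.symm : ResidueField Λ →+* l) p) :=
    fun r p h => by rw [RingEquiv.trans_apply, h, hτ₂]
  have hτC : ∀ lam : Λ, τ (Ideal.Quotient.mk _ (algebraMap Λ R lam)) =
      algebraMap l _ (eκ.symm (residue Λ lam)) := fun lam => by
    rw [hτ (algebraMap Λ R lam) (MvPolynomial.C (residue Λ lam)) (by rw [heR]; rfl), MvPolynomial.map_C]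
    rfl
  -- the prime `𝔔_l` and the localization
  set 𝔔l : Ideal (AlgebraicNodeRing l (eκ.symm abar)) :=
    (𝔔.map (Ideal.Quotient.mk ((maximalIdeal Λ).map (algebraMap Λ R)))).map τ.toRingHom with h𝔔l
  haveI h𝔔lp : 𝔔l.IsPrime := Ideal.map_isPrime_of_equiv τ
  have hmem : ∀ z, τ z ∈ 𝔔l ↔ z ∈ 𝔔.map (Ideal.Quotient.mk ((maximalIdeal Λ).map (algebraMap Λ R))) :=
    fun z => mem_map_ringEquiv_iff τ _ z
  have hmemR : ∀ r : R, τ (Ideal.Quotient.mk _ r) ∈ 𝔔l ↔ r ∈ 𝔔 := fun r => by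
    rw [hmem, Ideal.mem_quotient_iff_mem_sup, sup_eq_left.mpr h𝔔Λ]
  have H : (𝔔.map (Ideal.Quotient.mk ((maximalIdeal Λ).map (algebraMap Λ R)))).primeCompl.map
      τ.toMonoidHom = 𝔔l.primeCompl := by
    ext z
    simp only [Submonoid.mem_map, Ideal.mem_primeCompl_iff]
    constructor
    · rintro ⟨w, hw, rfl⟩
      change τ w ∉ 𝔔l
      rwa [hmem]
    · intro hz
      refine ⟨τ.symm z, ?_, ?_⟩
      · rw [← hmem, RingEquiv.apply_symm_apply]; exact hz
      · change τ (τ.symm z) = z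
        exact RingEquiv.apply_symm_apply τ z
  let ι : (T ⧸ (((maximalIdeal Λ).map (algebraMap Λ R)).map (algebraMap R T))) ≃+*
      Localization.AtPrime 𝔔l :=
    IsLocalization.ringEquivOfRingEquiv
      (M := (𝔔.map (Ideal.Quotient.mk ((maximalIdeal Λ).map (algebraMap Λ R)))).primeCompl)
      (T := 𝔔l.primeCompl) (T ⧸ (((maximalIdeal Λ).map (algebraMap Λ R)).map (algebraMap R T)))
      (Localization.AtPrime 𝔔l) τ H
  have hι : ∀ z, ι (algebraMap (R ⧸ (maximalIdeal Λ).map (algebraMap Λ R)) _ z) =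
      algebraMap _ (Localization.AtPrime 𝔔l) (τ z) :=
    fun z => IsLocalization.ringEquivOfRingEquiv_eq H z
  refine ⟨𝔔l, h𝔔lp, ι, fun r p h => ?_, fun lam => ?_⟩
  · rw [← hτ r p h, hmemR]
  · rw [IsScalarTower.algebraMap_apply l (AlgebraicNodeRing l (eκ.symm abar)) (Localization.AtPrime 𝔔l),
      ← hτC, ← hι, Ideal.Quotient.algebraMap_quotient_map_quotient]

end ChartFibre

section Chart

/-- **The special fibre `T/𝔪_Λ T` of the chart `T = R_𝔔`, `R = Λ[x, y]/(xy - a₀)`, is the local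
ring of the model `l[x, y]/(xy - ā)` at a prime `𝔔_l`**, for any copy `eκ : l ≅ Λ/𝔪_Λ` of the
residue field (`ā ∈ l` the copy of the residue of `a₀`): `𝔔_l` contains `x̄` (resp. `ȳ`) iff `𝔔`
does, and the identification sends the class of a scalar `λ ∈ Λ` to the copy of its residue
(`R/𝔪_Λ R ≅ (Λ/𝔪_Λ)[x, y]/(xy - ā)`, `AlgebraicNodeRing.quotientEquiv`, and the abstract form).
[cite: DeJong1996, 3.4 Claim (ii), p. 64] -/
theorem exists_chartFibre_equiv_localization_model {Λ : Type u} [CommRing Λ] [IsLocalRing Λ] {a₀ : Λ}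
    (𝔔 : Ideal (AlgebraicNodeRing Λ a₀)) [𝔔.IsPrime]
    (h𝔔Λ : (maximalIdeal Λ).map (algebraMap Λ (AlgebraicNodeRing Λ a₀)) ≤ 𝔔)
    (T : Type u) [CommRing T] [Algebra (AlgebraicNodeRing Λ a₀) T] [IsLocalization.AtPrime T 𝔔]
    (l : Type u) [Field l] (eκ : l ≃+* ResidueField Λ) :
    ∃ (𝔔l : Ideal (AlgebraicNodeRing l (eκ.symm (residue Λ a₀)))) (_ : 𝔔l.IsPrime)
      (ι : (T ⧸ ((maximalIdeal Λ).map (algebraMap Λ (AlgebraicNodeRing Λ a₀))).map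
          (algebraMap (AlgebraicNodeRing Λ a₀) T)) ≃+* Localization.AtPrime 𝔔l),
      (AlgebraicNodeRing.u l (eκ.symm (residue Λ a₀)) ∈ 𝔔l ↔ AlgebraicNodeRing.u Λ a₀ ∈ 𝔔) ∧
      (AlgebraicNodeRing.v l (eκ.symm (residue Λ a₀)) ∈ 𝔔l ↔ AlgebraicNodeRing.v Λ a₀ ∈ 𝔔) ∧
      (∀ lam : Λ, ι (Ideal.Quotient.mk _ (algebraMap (AlgebraicNodeRing Λ a₀) T
          (algebraMap Λ (AlgebraicNodeRing Λ a₀) lam))) =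
        algebraMap l (Localization.AtPrime 𝔔l) (eκ.symm (residue Λ lam))) := by
  obtain ⟨𝔔l, h𝔔lp, ι, hmem, hι⟩ :=
    exists_quotient_equiv_localization_model_of_quotient_equiv 𝔔 h𝔔Λ T l eκ
      (AlgebraicNodeRing.quotientEquiv Λ a₀ (maximalIdeal Λ))
      (fun lam => AlgebraicNodeRing.quotientEquiv_mk_algebraMap Λ a₀ (maximalIdeal Λ) lam)
  refine ⟨𝔔l, h𝔔lp, ι, ?_, ?_, hι⟩
  · have h := hmem (AlgebraicNodeRing.u Λ a₀) (MvPolynomial.X 0)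
      (AlgebraicNodeRing.quotientEquiv_mk_u Λ a₀ (maximalIdeal Λ))
    rwa [MvPolynomial.map_X] at h
  · have h := hmem (AlgebraicNodeRing.v Λ a₀) (MvPolynomial.X 1)
      (AlgebraicNodeRing.quotientEquiv_mk_v Λ a₀ (maximalIdeal Λ))
    rwa [MvPolynomial.map_X] at h

end Chart

end Summit.ResolutionOfSingularities.ResolutionOfSingularities.Theorems

end
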